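import Mathlib.Geometry.Manifold.PartitionOfUnity
import Mathlib.Analysis.SpecialFunctions.SmoothTransition
import HarnessLib

/-!
# `EIHFluxBalance.ModulatedKerrHandoff` (item stmt-FinalStateConjecture-17402): smooth receding schedules
# (real analysis for the kick ⊕ trim assembly of the trimming lines)

Pure real analysis used by `exists_tameCurve_of_kick_trim` (file `…KickTrimAssembly.lean`) of the two
trimming lines (`Lines/trim_kick_censorship.lean`, `Lines/trim_on_the_cure.lean`) of the crux:

* `exists_contDiff_ge_of_locally_bddAbove` — a locally bounded-above function on `ℝ` is dominated by a
  smooth one (smooth partitions of unity, `exists_contMDiffMap_forall_mem_convex_of_local_const`);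
* `exists_schedule` — a threshold `ρ₁` locally bounded on `(0, δ)` is dominated on `(0, δ/2)` by a schedule
  `ρ ≥ A`, smooth on `(0, ∞)`, with `ρ s → ∞` as `s → 0⁺`;
* `exists_contDiff_extension_Ici` — a function smooth on `(0, ∞)` and `≥ A` agrees on `[a, ∞)` with a
  globally smooth function `≥ A` (`Real.smoothTransition` cut-off);
* `locallyBdd_of_bddAbove_Icc` — bounded on compact subintervals ⇒ locally bounded (filter form).

Proofs carried verbatim from the strategist's skeleton `Lines/trim_kick_censorship.lean`
(planner-cstrat-stmt-FinalStateConjecture-17402-r1-0, 2026-08-17).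
-/

noncomputable section

namespace Summit.FinalStateConjecture.FinalStateConjecture.Theorems.EIHFluxBalance.TameTemplate

open scoped Topology Manifold ContDiff
open Filter Set Function

-- D-0017: single-problem summit, `Summit.<S>.<S>.…` by design.
set_option linter.dupNamespace false

/-- A function `φ : ℝ → ℝ` that is locally bounded above is dominated by a smooth function
(smooth partitions of unity: Mathlib's `exists_contMDiffMap_forall_mem_convex_of_local_const` on
the manifold `ℝ` with the convex sets `[φ x, ∞)`). [folklore] -/
theorem exists_contDiff_ge_of_locally_bddAbove (φ : ℝ → ℝ)
    (hφ : ∀ x : ℝ, ∃ C : ℝ, ∀ᶠ y in 𝓝 x, φ y ≤ C) :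
    ∃ g : ℝ → ℝ, ContDiff ℝ ∞ g ∧ ∀ x, φ x ≤ g x := by
  obtain ⟨g, hg⟩ := exists_contMDiffMap_forall_mem_convex_of_local_const (I := 𝓘(ℝ, ℝ)) (M := ℝ)
    (F := ℝ) (n := (⊤ : ℕ∞)) (t := fun x ↦ Ici (φ x)) (fun x ↦ convex_Ici _) (fun x ↦ by
      obtain ⟨C, hC⟩ := hφ x
      exact ⟨C, hC.mono fun y hy ↦ hy⟩)
  exact ⟨g, contMDiff_iff_contDiff.1 g.contMDiff, fun x ↦ hg x⟩

/-- **Smooth receding schedule dominating a locally bounded threshold.** If `ρ₁ : ℝ → ℝ` is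
locally bounded above on `(0, δ)`, then for every `A` there is `ρ : ℝ → ℝ`, smooth on `(0, ∞)`,
with `ρ ≥ A` on `(0, ∞)`, `ρ ≥ ρ₁` on `(0, δ/2)` and `ρ s → ∞` as `s → 0⁺` (dominate
`τ ↦ |A| + |τ| + ρ₁(1/τ)⁺` by a smooth function of `τ = 1/s`). [folklore] -/
theorem exists_schedule :
    ∀ {ρ₁ : ℝ → ℝ} {δ : ℝ}, 0 < δ → (∀ s : ℝ, 0 < s → s < δ → ∃ C : ℝ, ∀ᶠ s' in nhds s, ρ₁ s' ≤ C) → ∀ A : ℝ, ∃ ρ : ℝ → ℝ, ContDiffOn ℝ (⊤ : ℕ∞) ρ (Set.Ioi 0) ∧ (∀ s, 0 < s → A ≤ ρ s) ∧ (∀ s, 0 < s → s < δ / 2 → ρ₁ s ≤ ρ s) ∧ Filter.Tendsto ρ (nhdsWithin 0 (Set.Ioi 0)) Filter.atTop := by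
  intro ρ₁ δ hδ hbd A
  classical
  -- the threshold read in the variable `τ = 1/s`, cut off below `τ = 2/δ`
  set ψ : ℝ → ℝ := fun τ ↦ if 2 / δ ≤ τ then max (ρ₁ (1 / τ)) 0 else 0 with hψ
  set φ : ℝ → ℝ := fun τ ↦ |A| + |τ| + ψ τ with hφ
  have hψ0 : ∀ τ, 0 ≤ ψ τ := fun τ ↦ by
    simp only [hψ]
    split_ifs
    · exact le_max_right _ _
    · exact le_rfl
  have hloc : ∀ x : ℝ, ∃ C : ℝ, ∀ᶠ y in 𝓝 x, φ y ≤ C := by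
    intro τ₀
    -- local bound for `ψ`
    have hψloc : ∃ C : ℝ, ∀ᶠ τ in 𝓝 τ₀, ψ τ ≤ C := by
      by_cases hτ : 2 / δ ≤ τ₀
      · have hτ₀ : 0 < τ₀ := lt_of_lt_of_le (by positivity) hτ
        have hs₀ : 0 < 1 / τ₀ := by positivity
        have hs₀' : 1 / τ₀ < δ := by
          rw [div_lt_iff₀ hτ₀]
          have : 2 / δ * δ ≤ τ₀ * δ := by nlinarith
          have h2 : 2 / δ * δ = 2 := by field_simp
          nlinarith
        obtain ⟨C, hC⟩ := hbd (1 / τ₀) hs₀ hs₀'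
        have hcont : ContinuousAt (fun τ : ℝ ↦ 1 / τ) τ₀ :=
          (continuousAt_const.div continuousAt_id hτ₀.ne')
        have hpull : ∀ᶠ τ in 𝓝 τ₀, ρ₁ (1 / τ) ≤ C := hcont.eventually hC
        refine ⟨max C 0, hpull.mono fun τ hτ' ↦ ?_⟩
        simp only [hψ]
        split_ifs
        · exact max_le_max hτ' le_rfl
        · exact le_max_right _ _
      · push Not at hτ
        refine ⟨0, (eventually_lt_nhds hτ).mono fun τ hτ' ↦ ?_⟩
        simp only [hψ, if_neg (not_le.2 hτ')]
        exact le_rfl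
    obtain ⟨C, hC⟩ := hψloc
    have habs : ∀ᶠ τ in 𝓝 τ₀, |τ| ≤ |τ₀| + 1 := by
      have : ∀ᶠ τ in 𝓝 τ₀, dist τ τ₀ < 1 := Metric.ball_mem_nhds τ₀ one_pos
      refine this.mono fun τ hτ ↦ ?_
      rw [Real.dist_eq] at hτ
      have := abs_sub_abs_le_abs_sub τ τ₀
      linarith
    refine ⟨|A| + (|τ₀| + 1) + C, (hC.and habs).mono fun τ hτ ↦ ?_⟩
    simp only [hφ]
    linarith [hτ.1, hτ.2]
  obtain ⟨g, hg, hge⟩ := exists_contDiff_ge_of_locally_bddAbove φ hloc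
  have hφge : ∀ s, 0 < s → |A| + 1 / s + ψ (1 / s) ≤ g (1 / s) := fun s hs ↦ by
    have h := hge (1 / s)
    have : |1 / s| = 1 / s := abs_of_pos (by positivity)
    simp only [hφ, this] at h
    exact h
  refine ⟨fun s ↦ g (1 / s), ?_, ?_, ?_, ?_⟩
  · exact hg.comp_contDiffOn (contDiffOn_const.div contDiffOn_id fun x hx ↦ ne_of_gt hx)
  · intro s hs
    have h1 := hφge s hs
    have h2 : (0 : ℝ) ≤ 1 / s := by positivity
    have h3 := hψ0 (1 / s)
    have h4 : A ≤ |A| := le_abs_self A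
    linarith
  · intro s hs hsδ
    have h1 := hφge s hs
    have h2 : (0 : ℝ) ≤ 1 / s := by positivity
    have hcond : 2 / δ ≤ 1 / s := by
      rw [div_le_div_iff₀ hδ hs]
      linarith
    have h3 : ρ₁ s ≤ ψ (1 / s) := by
      simp only [hψ, if_pos hcond, one_div_one_div]
      exact le_max_left _ _
    have h4 : (0 : ℝ) ≤ |A| := abs_nonneg A
    linarith
  · have hev : ∀ᶠ s in 𝓝[>] (0 : ℝ), |A| + 1 / s ≤ g (1 / s) := by
      filter_upwards [self_mem_nhdsWithin] with s hs
      have h1 := hφge s hs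
      linarith [hψ0 (1 / s)]
    refine tendsto_atTop_mono' _ hev ?_
    have h1 : Tendsto (fun s : ℝ ↦ 1 / s) (𝓝[>] 0) atTop := by
      simpa only [one_div] using tendsto_inv_nhdsGT_zero (𝕜 := ℝ)
    exact tendsto_atTop_add_const_left _ _ h1

/-- **Smooth global modification of a function smooth on `(0, ∞)`**: given `ρ` smooth on `(0,∞)`
with `ρ ≥ A` there, and `a > 0`, there is a globally smooth `ρ' ≥ A` with `ρ' = ρ` on `[a, ∞)`
(cut off by `Real.smoothTransition` on `[a/2, a]`). [folklore] -/
theorem exists_contDiff_extension_Ici {ρ : ℝ → ℝ} {A a : ℝ} (hρ : ContDiffOn ℝ ∞ ρ (Ioi 0))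
    (hA : ∀ s, 0 < s → A ≤ ρ s) (ha : 0 < a) :
    ∃ ρ' : ℝ → ℝ, ContDiff ℝ ∞ ρ' ∧ (∀ s, A ≤ ρ' s) ∧ ∀ s, a ≤ s → ρ' s = ρ s := by
  set χ : ℝ → ℝ := fun s ↦ Real.smoothTransition ((s - a / 2) / (a / 2)) with hχ
  have hχ_smooth : ContDiff ℝ ∞ χ :=
    Real.smoothTransition.contDiff.comp ((contDiff_id.sub contDiff_const).div_const _)
  have hχ0 : ∀ s, s ≤ a / 2 → χ s = 0 := fun s hs ↦ by
    apply Real.smoothTransition.zero_of_nonpos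
    apply div_nonpos_of_nonpos_of_nonneg <;> linarith
  have hχ1 : ∀ s, a ≤ s → χ s = 1 := fun s hs ↦ by
    apply Real.smoothTransition.one_of_one_le
    rw [le_div_iff₀ (by positivity)]
    linarith
  have hχnn : ∀ s, 0 ≤ χ s := fun s ↦ Real.smoothTransition.nonneg _
  refine ⟨fun s ↦ A + χ s * (ρ s - A), ?_, ?_, ?_⟩
  · refine contDiff_iff_contDiffAt.2 fun s ↦ ?_
    by_cases hs : s < a / 2
    · have hev : (fun s ↦ A + χ s * (ρ s - A)) =ᶠ[𝓝 s] fun _ ↦ A := by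
        filter_upwards [eventually_lt_nhds hs] with t ht
        rw [hχ0 t ht.le, zero_mul, add_zero]
      exact (contDiffAt_const.congr_of_eventuallyEq hev)
    · push Not at hs
      have hs0 : 0 < s := lt_of_lt_of_le (by positivity) hs
      have hρs : ContDiffAt ℝ ∞ ρ s := hρ.contDiffAt (Ioi_mem_nhds hs0)
      exact contDiffAt_const.add (hχ_smooth.contDiffAt.mul (hρs.sub contDiffAt_const))
  · intro s
    by_cases hs : 0 < s
    · have h1 : 0 ≤ χ s * (ρ s - A) := mul_nonneg (hχnn s) (by linarith [hA s hs])
      linarith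
    · push Not at hs
      have : χ s = 0 := hχ0 s (by linarith)
      show A ≤ A + χ s * (ρ s - A)
      rw [this, zero_mul, add_zero]
  · intro s hs
    show A + χ s * (ρ s - A) = ρ s
    rw [hχ1 s hs, one_mul]
    ring

/-- A threshold bounded on every compact subinterval of `(0, δ)` is locally bounded there
(filter form). [folklore] -/
theorem locallyBdd_of_bddAbove_Icc {ρ₁ : ℝ → ℝ} {δ : ℝ}
    (h : ∀ a b : ℝ, 0 < a → a ≤ b → b < δ → BddAbove (ρ₁ '' Set.Icc a b)) :
    ∀ s : ℝ, 0 < s → s < δ → ∃ C : ℝ, ∀ᶠ s' in 𝓝 s, ρ₁ s' ≤ C := by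
  intro s hs hsδ
  obtain ⟨C, hC⟩ := h (s / 2) ((s + δ) / 2) (by positivity) (by linarith) (by linarith)
  refine ⟨C, ?_⟩
  have hmem : Set.Icc (s / 2) ((s + δ) / 2) ∈ 𝓝 s := Icc_mem_nhds (by linarith) (by linarith)
  filter_upwards [hmem] with s' hs'
  exact hC ⟨s', hs', rfl⟩

end Summit.FinalStateConjecture.FinalStateConjecture.Theorems.EIHFluxBalance.TameTemplate

end
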